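import Mathlib
import Literature.Computability.QuantumComplexity.PermanentPairingCount
import Literature.GroupTheory.PermutationGroups.SmallIndexSubgroups

/-!
# `DivisionGap.PerMultiplesHard` (stmt-ValiantsHypothesis-5068), line `uncharged-face-walk`:
stub `stub_alignedRigidity` — a typed factor serves few permutations

Let `a ∈ ℝ≥0[x_ij]` (`n × n` variables) be *typed*: every monomial of `a` has row margins `ρ`
and column margins `γ`, and let `k := #{i | ρ i ≠ 0}` lie in the balanced window
`n < 3k ≤ 2n`.  A permutation `π` is *served* by `a` if some monomial `B ∈ supp a` is supported
inside the perfect matching `{(π j, j)}`.  Then at most `⌊2n/3⌋! · (n - ⌊2n/3⌋)!` permutations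
are served.

Proof.
1. (`typed_of_served`) If `supp B ⊆ {(π j, j)}` then in row `π j` and in column `j` the only
   possibly nonzero cell of `B` is `(π j, j)`, so `ρ (π j) = B (π j, j) = γ j` for every `j`
   (`Finset.sum_eq_single`): the served permutations lie in `T := {π | ρ ∘ π = γ}`.
2. (`card_typed_le_card_stabilising`) If `T` is nonempty, fix `π₀ ∈ T`; then `π ↦ π * π₀⁻¹`
   injects `T` into the permutations stabilising the row support `Z := {i | ρ i ≠ 0}`
   (indeed `ρ ∘ (π * π₀⁻¹) = γ ∘ π₀⁻¹ = ρ`).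
3. The number of permutations of a finite type stabilising a `k`-set is `k! · (n - k)!`
   (`PermanentPairing.card_perm_stabilising`, a special case of Mathlib's
   `DomMulAct.stabilizer_card`); steps 1–3 are assembled, for an arbitrary finite index type, in
   `card_served_le_factorial`.
4. (`factorial_mul_factorial_le_window`) `k! (n - k)! ≤ m! (n - m)!` for `m := ⌊2n/3⌋`, because
   `k!(n-k)! · C(n,k) = n! = m!(n-m)! · C(n,m)` and `C(n,m) ≤ C(n,k)` by unimodality of the
   binomial coefficients (`n - m ≤ k ≤ m`; `PermutationGroups.choose_le_choose_of_le_of_le_sub`).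

Log (stub-worker): pure combinatorics over Mathlib; the set-stabiliser count is imported from
`Literature/Computability/QuantumComplexity/PermanentPairingCount.lean` and the unimodality of
the binomial coefficients (`choose_le_choose_of_le_of_le_sub`) from
`Literature/GroupTheory/PermutationGroups/SmallIndexSubgroups.lean` (a first draft re-proved the
latter inline; the gate flagged the copies as near-duplicates, so they are imported instead).
Steps 1–3 are stated over a general finite index type `ι` so that the decidability instances of
the intermediate filters agree with the imported lemma; only the final theorem specialises to
`Fin n`.
-/

noncomputable section

open MvPolynomial
open scoped NNReal BigOperators

namespace Summit.ValiantsHypothesis.ValiantsHypothesis.Theorems.DivisionGap.PerMultiplesHard.AlignedRigidity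

variable {ι : Type*} [Fintype ι] [DecidableEq ι]

/-! ### Step 1: typing pins a served permutation -/

omit [DecidableEq ι] in
/-- If a monomial `B` with row margins `ρ` and column margins `γ` is supported inside the perfect
matching `{(π j, j)}`, then `ρ (π j) = γ j` for every column `j`: both margins equal the single
entry `B (π j, j)`. [folklore] -/
theorem typed_of_served {ρ γ : ι → ℕ} {B : (ι × ι) →₀ ℕ}
    (hr : ∀ i, ∑ j, B (i, j) = ρ i) (hc : ∀ j, ∑ i, B (i, j) = γ j)
    (π : Equiv.Perm ι) (hB : ∀ e ∈ B.support, e.1 = π e.2) (j : ι) :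
    ρ (π j) = γ j := by
  have h1 : ∑ j', B (π j, j') = B (π j, j) := by
    refine Finset.sum_eq_single j (fun j' _ hj' => ?_) (by simp)
    by_contra h
    exact hj' (π.injective (hB (π j, j') (Finsupp.mem_support_iff.mpr h))).symm
  have h2 : ∑ i, B (i, j) = B (π j, j) := by
    refine Finset.sum_eq_single (π j) (fun i _ hi => ?_) (by simp)
    by_contra h
    exact hi (hB (i, j) (Finsupp.mem_support_iff.mpr h))
  rw [← hr (π j), ← hc j, h1, h2]

/-! ### Step 2: typed permutations inject into the stabiliser of the row support -/

/-- The permutations `π` with `ρ ∘ π = γ` are at most as many as the permutations stabilising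
the support `Z` of `ρ`: translating by a fixed solution `π₀` lands in the stabiliser of `ρ`,
hence of `Z`. [folklore] -/
theorem card_typed_le_card_stabilising (ρ γ : ι → ℕ) (Z : Finset ι)
    (hZ : ∀ i, i ∈ Z ↔ ρ i ≠ 0) :
    (Finset.univ.filter fun π : Equiv.Perm ι => ∀ j, ρ (π j) = γ j).card ≤
      (Finset.univ.filter fun ξ : Equiv.Perm ι => ∀ i, ξ i ∈ Z ↔ i ∈ Z).card := by
  rcases (Finset.univ.filter fun π : Equiv.Perm ι => ∀ j, ρ (π j) = γ j).eq_empty_or_nonempty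
    with hT | ⟨π₀, hπ₀⟩
  · rw [hT, Finset.card_empty]
    exact Nat.zero_le _
  · have h0 : ∀ j, ρ (π₀ j) = γ j := (Finset.mem_filter.mp hπ₀).2
    refine Finset.card_le_card_of_injOn (fun π => π * π₀⁻¹) (fun π hπ => ?_)
      (fun π _ π' _ h => mul_right_cancel h)
    have hπ' : ∀ j, ρ (π j) = γ j := (Finset.mem_filter.mp (Finset.mem_coe.mp hπ)).2
    simp only [Finset.coe_filter, Finset.mem_univ, true_and, Set.mem_setOf_eq]
    intro i
    have e1 : (π * π₀⁻¹) i = π (π₀.symm i) := rfl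
    rw [hZ, hZ, e1, hπ' (π₀.symm i), ← h0 (π₀.symm i), Equiv.apply_symm_apply]

/-! ### Steps 1–3 assembled over a general finite index type -/

/-- If every exponent in `S` has row margins `ρ` and column margins `γ`, then the permutations
served by `S` (some `B ∈ S` is supported inside the matching `{(π j, j)}`) number at most
`k! · (|ι| - k)!`, where `k` is the size of the support of `ρ`. [folklore] -/
theorem card_served_le_factorial (S : Finset ((ι × ι) →₀ ℕ)) (ρ γ : ι → ℕ)
    (hS : ∀ m ∈ S, (∀ i, ∑ j, m (i, j) = ρ i) ∧ (∀ j, ∑ i, m (i, j) = γ j)) :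
    (Finset.univ.filter fun π : Equiv.Perm ι => ∃ B ∈ S, ∀ e ∈ B.support, e.1 = π e.2).card ≤
      (Finset.univ.filter fun i => ρ i ≠ 0).card.factorial *
        (Fintype.card ι - (Finset.univ.filter fun i => ρ i ≠ 0).card).factorial := by
  set Z : Finset ι := Finset.univ.filter fun i => ρ i ≠ 0 with hZdef
  have hZ : ∀ i, i ∈ Z ↔ ρ i ≠ 0 := fun i => by simp [hZdef]
  rw [← Literature.Computability.QuantumComplexity.PermanentPairing.card_perm_stabilising Z]
  calc (Finset.univ.filter fun π : Equiv.Perm ι => ∃ B ∈ S, ∀ e ∈ B.support, e.1 = π e.2).card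
      ≤ (Finset.univ.filter fun π : Equiv.Perm ι => ∀ j, ρ (π j) = γ j).card := by
        refine Finset.card_le_card fun π hπ => ?_
        simp only [Finset.mem_filter, Finset.mem_univ, true_and] at hπ ⊢
        obtain ⟨B, hB, hBπ⟩ := hπ
        exact typed_of_served (hS B hB).1 (hS B hB).2 π hBπ
    _ ≤ (Finset.univ.filter fun ξ : Equiv.Perm ι => ∀ i, ξ i ∈ Z ↔ i ∈ Z).card :=
        card_typed_le_card_stabilising ρ γ Z hZ

/-! ### Step 4: the numeric comparison of `k!(n-k)!` with `⌊2n/3⌋!(n-⌊2n/3⌋)!` -/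

/-- In the balanced window `n < 3k ≤ 2n` one has `k! · (n - k)! ≤ ⌊2n/3⌋! · (n - ⌊2n/3⌋)!`:
with `m := ⌊2n/3⌋`, `k!(n-k)! · C(n,k) = n! = m!(n-m)! · C(n,m)` and `C(n,m) ≤ C(n,k)` since
`n - m ≤ k ≤ m`. [folklore] -/
theorem factorial_mul_factorial_le_window {n k : ℕ} (hlo : n < 3 * k) (hhi : 3 * k ≤ 2 * n) :
    k.factorial * (n - k).factorial ≤ (2 * n / 3).factorial * (n - 2 * n / 3).factorial := by
  set m := 2 * n / 3 with hm
  have hkm : k ≤ m := by omega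
  have hmk : n - m ≤ k := by omega
  have hmn : m ≤ n := by omega
  have hkn : k ≤ n := by omega
  have hc : n.choose m ≤ n.choose k := by
    rw [← Nat.choose_symm hmn]
    exact Literature.GroupTheory.PermutationGroups.choose_le_choose_of_le_of_le_sub hmk
      (by omega) hkn
  have h1 := Nat.choose_mul_factorial_mul_factorial hkn
  have h2 := Nat.choose_mul_factorial_mul_factorial hmn
  refine Nat.le_of_mul_le_mul_left ?_ (Nat.choose_pos hkn)
  calc n.choose k * (k.factorial * (n - k).factorial) = n.factorial := by rw [← mul_assoc, h1]
    _ = n.choose m * (m.factorial * (n - m).factorial) := by rw [← mul_assoc, h2]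
    _ ≤ n.choose k * (m.factorial * (n - m).factorial) := Nat.mul_le_mul_right _ hc

/-! ### The stub -/

/-- **stub_alignedRigidity (typed vertex count).**  If every monomial of `a` has row margins `ρ`
and column margins `γ`, and the row support `k := #{i | ρ i ≠ 0}` lies in the balanced window
`n < 3k ≤ 2n`, then at most `⌊2n/3⌋! · (n - ⌊2n/3⌋)!` permutations `π` are served by `a`
(some monomial of `a` is supported inside the matching `{(π j, j)}`): typing forces
`ρ ∘ π = γ`, such `π` form at most one coset of the stabiliser of the row support (of order
`k!(n-k)!`), and `k!(n-k)! ≤ ⌊2n/3⌋!(n-⌊2n/3⌋)!` in the window. [folklore] -/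
theorem stub_alignedRigidity (n : ℕ) (a : MvPolynomial (Fin n × Fin n) ℝ≥0) (ρ γ : Fin n → ℕ)
    (ha : ∀ m ∈ a.support, (∀ i, ∑ j, m (i, j) = ρ i) ∧ (∀ j, ∑ i, m (i, j) = γ j))
    (hlo : n < 3 * (Finset.univ.filter fun i => ρ i ≠ 0).card)
    (hhi : 3 * (Finset.univ.filter fun i => ρ i ≠ 0).card ≤ 2 * n) :
    (Finset.univ.filter fun π : Equiv.Perm (Fin n) =>
        ∃ B ∈ a.support, ∀ e ∈ B.support, e.1 = π e.2).card ≤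
      (2 * n / 3).factorial * (n - 2 * n / 3).factorial := by
  have key := card_served_le_factorial a.support ρ γ ha
  rw [Fintype.card_fin] at key
  exact key.trans (factorial_mul_factorial_le_window hlo hhi)

end Summit.ValiantsHypothesis.ValiantsHypothesis.Theorems.DivisionGap.PerMultiplesHard.AlignedRigidity

end
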